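import Summits.QuantumFields.YangMills.Theorems.LocalInsertionHistoryTailOfInteriorHeights
import Summits.QuantumFields.YangMills.Theorems.LocalInsertionHistoryTailOfLinExpTail
import HarnessLib

/-!
# Crux `HistoryTailL` (stmt-QuantumFields-19936) — INTERIOR HEIGHTS SUFFICE, BY NAME: the three per-plaquette doors into
# `UnitScaleTilt.HistoryTailL` (geometric floor, linear-exponential, Gaussian-with-prefactor) with hypotheses asked ONLY at the heights `j + 2 ≤ K`

Cell `ym3-torus` (YM ladder rung R3 = continuum SU(2) Yang–Mills on the three-torus — a RUNG, NOT the Clay problem: not d = 4, not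
infinite volume, not a mass gap), width seat `ym-ust-19936-w3` gen 11, `--supports stmt-QuantumFields-19936 --as helper`.  THEOREMS ONLY,
definition-free; by-name layer (route cone: names `Theses.UnitScaleTilt.HistoryTailL`).  HONEST FRAMING: CONDITIONAL packaging doors; the
per-plaquette hypotheses are NOT in the tree; nothing of `HistoryTailL`, `LocalInsertionL` (23607) or any crux/summit statement is proved.

WHY.  The existing doors ✓`EntropyFloorHistoryTailOfGeometric.historyTailL_of_geometricTail`, ✓`LocalInsertionLinExpDoor.historyTailL_of_linExpTail`
and ✓`T3AveragedTailProfile.historyTailAt_of_perPlaquette` ask their per-plaquette bound at EVERY height `1 ≤ j ≤ K`.  By the route-independent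
✓`LocalInsertion.InteriorHeights` (interior heights suffice for `HistoryTailAt`: the top two heights only occur on the wedge for `K ≤ 2m` and are
charged the trivial bound), the same three doors hold with the hypothesis restricted to the INTERIOR heights `j + 2 ≤ K` — so a supplier (e.g.
route LocalInsertion's insertion bound, whose top heights are outside the K1 box, ✓`InsertionStepOfConcentrationBoxFit`) may ignore the two top heights.
* ★★`historyTailL_of_geometricTail_interior`, ★★`historyTailL_of_linExpTail_interior` (`b₀ := max(max b₁ 1, 8/ε)`, `p₀ := max p₁ 3`,
  `ρ := exp(−εb₀·log L/2)`, exactly as the all-heights door), ★★`historyTailL_of_perPlaquette_interior`.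
[cite: Balaban1985UV3, (7) p.257 and (71) p.273; King1986, (3.12) p.657]
-/

set_option autoImplicit false

noncomputable section

open scoped BigOperators
open MeasureTheory
open Literature.MathematicalPhysics.QuantumFieldTheory.Balaban1983to89
open Literature.MathematicalPhysics.QuantumFieldTheory.Balaban1983to89.T3ContinuumYM3Torus
open Literature.MathematicalPhysics.QuantumFieldTheory.Balaban1983to89.T3UnitScaleTilt
open Literature.MathematicalPhysics.QuantumFieldTheory.Balaban1983to89.T3UnitLawDensityEML
open Summit.QuantumFields.YangMills.Theorems.LocalInsertion.InteriorHeights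
  (historyTailAt_of_geometricTail_interior historyTailAt_of_perPlaquette_interior)
open Summit.QuantumFields.YangMills.Theorems.LocalInsertionLinExpDoor (exp_neg_mul_pFun_le_pow)

namespace Summit.QuantumFields.YangMills.Theorems.LocalInsertion.InteriorHeightsL

/-- **THE GEOMETRIC FLOOR DOOR, INTERIOR HEIGHTS ONLY**: the hypothesis of ✓`historyTailL_of_geometricTail` with `j ≤ K` weakened to `j + 2 ≤ K`
still gives `UnitScaleTilt.HistoryTailL` (stmt-QuantumFields-19936, BY NAME).  CONDITIONAL. [cite: Balaban1985UV3, (71) p.273] -/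
theorem historyTailL_of_geometricTail_interior
    (hG : ∀ (L : ℕ) (b₁ p₁ : ℝ), ∃ (b₀ p₀ : ℝ), b₁ ≤ b₀ ∧ p₁ ≤ p₀ ∧ 0 < b₀ ∧ 2 < p₀ ∧ ∃ γ₁ : ℝ, 0 < γ₁ ∧ γ₁ ≤ 1 ∧
      ∀ (F : T3Family) (γ : ℝ), F.L = L → 0 < γ → γ ≤ γ₁ → ∃ (D ρ : ℝ), 0 ≤ D ∧ 0 ≤ ρ ∧ ρ * (L : ℝ) ^ 3 < 1 ∧
        ∀ (K j : ℕ), 1 ≤ j → j + 2 ≤ K → ∀ (p : Plaq (F.P K) j),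
          (gibbsK F ℰp γ K).real {U | θBal F.L γ b₀ p₀ (K - j) ≤
              GaugeGroup.dist1 (GaugeField.plaqHol (Averaging.iter (fun i => BlockAveraging.blockAvg (P := F.P K) (j := i) ℰp) j U) p)}
            ≤ D * ρ ^ (K - j)) :
    Summit.QuantumFields.YangMills.Theses.UnitScaleTilt.HistoryTailL := by
  unfold Summit.QuantumFields.YangMills.Theses.UnitScaleTilt.HistoryTailL
  intro L b₁ p₁
  obtain ⟨b₀, p₀, hb, hp, hb₀, hp₀, γ₁, hγ₁, hγ₁1, hfam⟩ := hG L b₁ p₁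
  refine ⟨b₀, p₀, hb, hp, hb₀, hp₀, fun m hm => ⟨γ₁, hγ₁, fun F γ hFL hγ hγle => ?_⟩⟩
  obtain ⟨D, ρ, hD, hρ, hρL, hbound⟩ := hfam F γ hFL hγ hγle
  refine historyTailAt_of_geometricTail_interior F hγ (hγle.trans hγ₁1) hb₀ (by linarith) hm ⟨D, ρ, hD, hρ, ?_,
    fun K j hj hjK _ p => hbound K j hj hjK p⟩
  rw [hFL]
  exact hρL

/-- **THE LINEAR-EXPONENTIAL DOOR, INTERIOR HEIGHTS ONLY**: as ✓`historyTailL_of_linExpTail` (for every `L` one `ε > 0`; for ALL profiles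
`b₀ > 0`, `p₀ > 2` constants `M₀ ≥ 0`, `γ₁ ∈ (0,1]` with `Gibbs_K{θ(K−j) ≤ dist1(Ū^j(∂p))} ≤ M₀·exp(−ε·p(g_{K−j}))`), but asked only at the
heights `j + 2 ≤ K`; conclusion `UnitScaleTilt.HistoryTailL` (BY NAME) with `b₀ := max(max b₁ 1, 8/ε)`, `p₀ := max p₁ 3`,
`ρ := exp(−ε b₀ log L/2)`, `ρ·L³ < 1`.  CONDITIONAL; monotone in `ε` as the all-heights door. [cite: Balaban1985UV3, (7) p.257 and (71) p.273] -/
theorem historyTailL_of_linExpTail_interior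
    (h : ∀ (L : ℕ), ∃ ε : ℝ, 0 < ε ∧ ∀ (b₀ p₀ : ℝ), 0 < b₀ → 2 < p₀ → ∃ M₀ : ℝ, 0 ≤ M₀ ∧ ∃ γ₁ : ℝ, 0 < γ₁ ∧ γ₁ ≤ 1 ∧
      ∀ (F : T3Family) (γ : ℝ), F.L = L → 0 < γ → γ ≤ γ₁ → ∀ (K j : ℕ), 1 ≤ j → j + 2 ≤ K → ∀ (p : Plaq (F.P K) j),
        (gibbsK F ℰp γ K).real {U | θBal F.L γ b₀ p₀ (K - j) ≤
              GaugeGroup.dist1 (GaugeField.plaqHol (Averaging.iter (fun i => BlockAveraging.blockAvg (P := F.P K) (j := i) ℰp) j U) p)}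
          ≤ M₀ * Real.exp (-(ε * B10.pFun b₀ p₀ (Real.sqrt (γ * ((F.L : ℝ)⁻¹) ^ (K - j)))))) :
    Summit.QuantumFields.YangMills.Theses.UnitScaleTilt.HistoryTailL := by
  refine historyTailL_of_geometricTail_interior fun L b₁ p₁ => ?_
  obtain ⟨ε, hε, hprof⟩ := h L
  set b₀ : ℝ := max (max b₁ 1) (8 / ε) with hb₀def
  set p₀ : ℝ := max p₁ 3 with hp₀def
  have hb₀1 : 1 ≤ b₀ := (le_max_right b₁ 1).trans (le_max_left _ _)
  have hb₀0 : 0 < b₀ := lt_of_lt_of_le one_pos hb₀1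
  have hb₀ε : 8 / ε ≤ b₀ := le_max_right _ _
  have hp₀3 : 3 ≤ p₀ := le_max_right _ _
  obtain ⟨M₀, hM₀, γ₁, hγ₁, hγ₁1, hfam⟩ := hprof b₀ p₀ hb₀0 (by linarith)
  refine ⟨b₀, p₀, (le_max_left b₁ 1).trans (le_max_left _ _), le_max_left _ _, hb₀0, by linarith, γ₁, hγ₁, hγ₁1,
    fun F γ hFL hγ hγle => ?_⟩
  have hL1 : 1 < L := by rw [← hFL]; exact F.hL.2
  have hL1' : (1 : ℝ) < L := by exact_mod_cast hL1
  have hlogL : 0 < Real.log L := Real.log_pos hL1'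
  refine ⟨M₀, Real.exp (-(ε * b₀ * Real.log L / 2)), hM₀, (Real.exp_pos _).le, ?_, fun K j hj hjK p => ?_⟩
  · have hεb : 8 ≤ ε * b₀ := by
      have := mul_le_mul_of_nonneg_left hb₀ε hε.le
      rwa [mul_div_cancel₀ _ hε.ne'] at this
    have hL3 : (L : ℝ) ^ 3 = Real.exp (3 * Real.log L) := by
      rw [← Real.exp_log (by linarith : (0 : ℝ) < L), ← Real.exp_nat_mul, Real.exp_log (by linarith : (0 : ℝ) < L)]
      norm_num
    rw [hL3, ← Real.exp_add, ← Real.exp_zero]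
    exact Real.exp_lt_exp.mpr (by nlinarith)
  · have htail := hfam F γ hFL hγ hγle K j hj hjK p
    refine htail.trans (mul_le_mul_of_nonneg_left ?_ hM₀)
    rw [hFL]
    exact exp_neg_mul_pFun_le_pow hL1.le hγ (hγle.trans hγ₁1) hε.le hb₀0.le (by linarith) (K - j)

/-- **THE GAUSSIAN-WITH-PREFACTOR DOOR, INTERIOR HEIGHTS ONLY**: the per-plaquette schema `C·β_{K−j}^A·e^{−c·p(g_{K−j})²}` of
✓`T3AveragedTailProfile.historyTailAt_of_perPlaquette`, L-uniformly packaged (profile beyond any thresholds, one `γ₁ ≤ 1` per profile serving every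
`m`, constants `C, A, c` per family and coupling), asked only at the heights `j + 2 ≤ K`, gives `UnitScaleTilt.HistoryTailL` (BY NAME).  CONDITIONAL.
[cite: Balaban1985UV3, (7) p.257 and (71) p.273] -/
theorem historyTailL_of_perPlaquette_interior
    (hP : ∀ (L : ℕ) (b₁ p₁ : ℝ), ∃ (b₀ p₀ : ℝ), b₁ ≤ b₀ ∧ p₁ ≤ p₀ ∧ 0 < b₀ ∧ 2 < p₀ ∧ ∃ γ₁ : ℝ, 0 < γ₁ ∧ γ₁ ≤ 1 ∧
      ∀ (F : T3Family) (γ : ℝ), F.L = L → 0 < γ → γ ≤ γ₁ → ∃ (C : ℝ) (A : ℕ) (c : ℝ), 0 ≤ C ∧ 0 < c ∧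
        ∀ (K j : ℕ), 1 ≤ j → j + 2 ≤ K → ∀ (p : Plaq (F.P K) j),
          (gibbsK F ℰp γ K).real {U | θBal F.L γ b₀ p₀ (K - j) ≤
              GaugeGroup.dist1 (GaugeField.plaqHol (Averaging.iter (fun i => BlockAveraging.blockAvg (P := F.P K) (j := i) ℰp) j U) p)}
            ≤ C * (F.scheme ℰp γ).β (K - j) ^ A *
              Real.exp (-(c * B10.pFun b₀ p₀ (Real.sqrt (γ * ((F.L : ℝ)⁻¹) ^ (K - j))) ^ 2))) :
    Summit.QuantumFields.YangMills.Theses.UnitScaleTilt.HistoryTailL := by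
  unfold Summit.QuantumFields.YangMills.Theses.UnitScaleTilt.HistoryTailL
  intro L b₁ p₁
  obtain ⟨b₀, p₀, hb, hp, hb₀, hp₀, γ₁, hγ₁, hγ₁1, hfam⟩ := hP L b₁ p₁
  refine ⟨b₀, p₀, hb, hp, hb₀, hp₀, fun m hm => ⟨γ₁, hγ₁, fun F γ hFL hγ hγle => ?_⟩⟩
  obtain ⟨C, A, c, hC, hc, hbound⟩ := hfam F γ hFL hγ hγle
  exact historyTailAt_of_perPlaquette_interior F hγ (hγle.trans hγ₁1) hb₀ (by linarith) hm
    ⟨C, A, c, hC, hc, fun K j hj hjK _ p => hbound K j hj hjK p⟩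

end Summit.QuantumFields.YangMills.Theorems.LocalInsertion.InteriorHeightsL
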